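import Summits.HodgeConjecture.HodgeConjecture.Theorems.K2E3BranchBSkewLineCharacterIntegral     -- ★ (K2E3-p04) `dite_chi_units_mul` (`E(u·b) = χ₁(u)·E(b)`); brings ★ `K2E3BranchBSkewLineIntegrals` (`smulSkew` substitution pattern, `exists_conjLocal_skew_unit`), the `HeisRing` chart
import HarnessLib

/-!
# R90 · S1 ∕ U4Keys leaf (U4f-χ₁-ram-one-d0B) — THE SKEW-SPHERE CHARACTER INTEGRAL VANISHES: `∫_{y ∈ R⁻ : |y|_w = q_w} χ₁(ŷ) dμ⁻ = 0` as soon as `χ₁` is non-trivial on ONE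
# `σ`-fixed unit of valuation one (the atom of the ramified odd-shell identity `∫_{Sh 1} F₀ = 0`, ★∕📤 `R90S1RamifiedShellOneFibre`)
# [Keys1984 §5, §7 Thm (2) (d); WeilBNT1967 Ch. II §5; Rogawski1990 §1.10, §12.2 (2); PAPER-Z3-DepthZeroRamified §1 (R90-C10-p05 (g0), r01-screened)]

Cell `hodgecm-mathlib`, SLAB R90-TF, section S1 «Ch. 12 local», crux H413 = `stmt-HodgeConjecture-24833` (lane `--supports … --as helper`), route HCCMUnconditional; prover seat
`hodgecm-mathlib-R90-C10-p05` (g0); socket of record S1#3′ = K2E3 leaf (U4f-χ₁-ram-one) ⊇ U4Keys :155 (depth 0, Branch B).  THEOREMS ONLY (no definition ∕ instance ∕ notation ∕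
named fact ∕ `sorry`); ★-only imports.  FRAME (v1 spellings): `R := LocalRing L v`, `σ := conjLocal L c v`, `R⁻ = skewPart σ`, `v` non-split (`hw`); `μ⁻ = μY` a regular additive Haar
measure on `R⁻`; `E r := χ₁(r̂)` if `r ∈ Rˣ` else `0`.

THE POINT.  ★∕📤 `R90S1RamifiedShellOneFibre.heisZFibreOne_eq_skewSphereIntegral_ram` reduces the ramified odd-shell identity to the vanishing of `∫_{|y|_w = q_w} E(y) dμ⁻` over the skew
sphere of radius `q_w`.  This file proves that vanishing — for ANY radius `ρ` — by the orthogonality trick of ★ `K2E3BranchBSkewLineCharacterIntegral.integral_indicator_sphere_dite_eq_zero`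
transported to the skew line: a `σ`-FIXED unit `b₀` with `|b₀|_w = 1` and `χ₁(b₀) ≠ 1` acts on `R⁻` by `y ↦ b₀y` (★ `HeisRing.smulSkew`), preserving `μ⁻` (★ `map_smulSkew_eq`, modulus
`√‖b₀‖_R = 1` ★ `skewModulus_eq_sqrt`, ★ `unitModulusChar_eq_one_of_forall_v_eq_one`) and every sphere `{|y|_w = ρ}`, while `E(b₀y) = χ₁(b₀)·E(y)` (★ `dite_chi_units_mul`); hence
`I = χ₁(b₀)·I`, `I = 0`.  At a tame RAMIFIED place in Branch B at depth zero such a `b₀` exists: `χ₁` is non-trivial on `𝒪_E^×` (`hram`), trivial on `1 + 𝔭_E` (`hdepth`), and `𝒪_F^× ↠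
(𝒪_E ∕ 𝔭_E)^× = 𝔽_q^×` (`f(w|v) = 1`) — that existence is a separate brick; here `b₀` is a letter.
* **`skewSphereIntegral_dite_chi_eq_zero_of_fixed_unit`**.
HONEST LABEL.  HC_CM is proved only modulo the 7 printed citations (2 remaining named inputs: hLiu418 = `stmt-HodgeConjecture-24832`, h413 = `stmt-HodgeConjecture-24833`) until rung 0
closes; count-neutral — this file does NOT pay the leaf; no printed citation is discharged.

## References
* [Keys1984] D. Keys, *Principal series representations of special unitary groups over local fields*, Compositio Math. 51 (1984), §5, §7 Theorem (2) (d) p. 126.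
* [WeilBNT1967] A. Weil, *Basic Number Theory* (1967), Ch. II §5 (orthogonality of characters of compact groups; moduli of automorphisms).
* [Rogawski1990] J. D. Rogawski, *Automorphic Representations of Unitary Groups in Three Variables*, Ann. of Math. Stud. 123 (1990), §1.10 p. 9, §12.2 (2) p. 173.
-/

set_option autoImplicit false
-- the mandated namespace has the single-problem summit's repeated segment (`HodgeConjecture.HodgeConjecture`)
set_option linter.dupNamespace false

noncomputable section

open NumberField IsDedekindDomain MeasureTheory Measure Topology Set
open scoped NNReal ENNReal
open Literature.NumberTheory Literature.NumberTheory.Automorphic Literature.NumberTheory.Automorphic.UnitaryGroup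

namespace Summit.HodgeConjecture.HodgeConjecture.R90.S1

open Summit.HodgeConjecture.HodgeConjecture.Cruxes.H413
open Summit.HodgeConjecture.HodgeConjecture.Cruxes.H413.K2E3BranchBSkewUnitSign
open Summit.HodgeConjecture.HodgeConjecture.Cruxes.H413.K2E3BranchBSkewLineIntegrals
open Summit.HodgeConjecture.HodgeConjecture.Cruxes.H413.K2E3BranchBSkewLineCharacterIntegral

variable (L : Type) [Field L] [NumberField L] [IsCMField L] (v : HeightOneSpectrum (𝓞 ↥(maximalRealSubfield L)))
  (w : PlacesOver L v) (hw : IsCMField.complexConj L • w.1 = w.1)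

set_option linter.overlappingInstances false in  -- `[μY.IsAddHaarMeasure] [μY.Regular]` are the binders of ★ `HeisRing.map_smulSkew_eq`
include hw in
open scoped Classical in
/-- **THE SKEW-SPHERE CHARACTER INTEGRAL VANISHES**: for a regular additive Haar measure `μ⁻` on `R⁻`, any radius `ρ`, and a `σ`-FIXED unit `b₀ ∈ Rˣ` with `|b₀|_w = 1` and `χ₁(b₀) ≠ 1`:
`∫_{y ∈ R⁻ : |y_w|_w = ρ} E(y) dμ⁻ = 0` (`E r = χ₁(r̂)` on units, `0` off units).  The substitution `y ↦ b₀y` (★ `HeisRing.smulSkew`, `μ⁻`-preserving since `√‖b₀‖_R = 1`, sphere-preserving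
since `|b₀|_w = 1`) multiplies the integrand by `χ₁(b₀)` (★ `dite_chi_units_mul`), so `I = χ₁(b₀)·I`.  With `ρ = q_w` this is the atom of the ramified odd-shell identity.
[cite: WeilBNT1967, Ch. II §5] [cite: Keys1984, §5, §7 Theorem (2) (d) p. 126] [cite: Rogawski1990, §1.10 p. 9] -/
theorem skewSphereIntegral_dite_chi_eq_zero_of_fixed_unit [MeasurableSpace (LocalRing L v)] [BorelSpace (LocalRing L v)]
    (μY : Measure ↥(HeisRing.skewPart (conjLocal L (IsCMField.complexConj L) v))) [μY.IsAddHaarMeasure] [μY.Regular]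
    (χ₁ : (LocalRing L v)ˣ →* ℂˣ) (b₀ : (LocalRing L v)ˣ) (hb₀fix : conjLocal L (IsCMField.complexConj L) v (b₀ : LocalRing L v) = b₀)
    (hb₀v : Valued.v ((b₀ : LocalRing L v) w) = 1) (hχ : χ₁ b₀ ≠ 1) (ρ : WithZero (Multiplicative ℤ)) :
    ∫ y in {y : ↥(HeisRing.skewPart (conjLocal L (IsCMField.complexConj L) v)) | Valued.v ((y : LocalRing L v) w) = ρ},
        (fun r : LocalRing L v => if h : IsUnit r then ((χ₁ h.unit : ℂˣ) : ℂ) else 0) (y : LocalRing L v) ∂μY = 0 := by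
  have hσ := conjLocal_conjLocal_cm L v
  have hσc := continuous_conjLocal L (IsCMField.complexConj L) v
  set S : Set ↥(HeisRing.skewPart (conjLocal L (IsCMField.complexConj L) v)) :=
    {y | Valued.v ((y : LocalRing L v) w) = ρ} with hSdef
  set E : LocalRing L v → ℂ := fun r : LocalRing L v => if h : IsUnit r then ((χ₁ h.unit : ℂˣ) : ℂ) else 0 with hEdef
  set c : ℂ := ((χ₁ b₀ : ℂˣ) : ℂ) with hcdef
  -- the substitution `y ↦ b₀ y` preserves `μ⁻`
  set T := HeisRing.smulSkew (conjLocal L (IsCMField.complexConj L) v) b₀ hb₀fix with hT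
  obtain ⟨δ, hδ⟩ := exists_conjLocal_skew_unit L v
  have hmod : HeisRing.skewModulus (conjLocal L (IsCMField.complexConj L) v) hσc b₀ hb₀fix = 1 := by
    rw [HeisRing.skewModulus_eq_sqrt (conjLocal L (IsCMField.complexConj L) v) hσ hσc δ hδ b₀ hb₀fix,
      show distribHaarChar (LocalRing L v) b₀ = unitModulusChar (LocalRing L v) b₀ from rfl,
      unitModulusChar_eq_one_of_forall_v_eq_one L v b₀ (forall_placesOver_of_apply L v w hw hb₀v), NNReal.sqrt_one]
  have hpres : MeasurePreserving T μY μY := by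
    refine ⟨T.continuous.measurable, ?_⟩
    rw [hT, HeisRing.map_smulSkew_eq (conjLocal L (IsCMField.complexConj L) v) hσc b₀ hb₀fix μY, hmod, inv_one, one_smul]
  -- … and every sphere
  have hpre : T ⁻¹' S = S := by
    ext y
    rw [Set.mem_preimage, hSdef, Set.mem_setOf_eq, Set.mem_setOf_eq, hT, HeisRing.coe_smulSkew, Pi.mul_apply, map_mul, hb₀v, one_mul]
  have key := hpres.setIntegral_preimage_emb T.toHomeomorph.measurableEmbedding
    (fun y : ↥(HeisRing.skewPart (conjLocal L (IsCMField.complexConj L) v)) => E (y : LocalRing L v)) S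
  rw [hpre] at key
  -- … and multiplies the integrand by `χ₁(b₀)`
  have hGT : ∀ y : ↥(HeisRing.skewPart (conjLocal L (IsCMField.complexConj L) v)),
      E ((T y : ↥(HeisRing.skewPart (conjLocal L (IsCMField.complexConj L) v))) : LocalRing L v) = c * E (y : LocalRing L v) := by
    intro y
    rw [hT, HeisRing.coe_smulSkew]
    exact dite_chi_units_mul L v χ₁ b₀ (y : LocalRing L v)
  have key2 : ∫ y in S, E (y : LocalRing L v) ∂μY = c * ∫ y in S, E (y : LocalRing L v) ∂μY := by
    calc ∫ y in S, E (y : LocalRing L v) ∂μY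
        = ∫ y in S, E ((T y : ↥(HeisRing.skewPart (conjLocal L (IsCMField.complexConj L) v))) : LocalRing L v) ∂μY := key.symm
      _ = ∫ y in S, c * E (y : LocalRing L v) ∂μY := integral_congr_ae (Filter.Eventually.of_forall hGT)
      _ = c * ∫ y in S, E (y : LocalRing L v) ∂μY := integral_const_mul _ _
  have hc : c ≠ 1 := by
    rw [hcdef, Ne, Units.val_eq_one]
    exact hχ
  have h0 : (1 - c) * ∫ y in S, E (y : LocalRing L v) ∂μY = 0 := by rw [sub_mul, one_mul, ← key2, sub_self]
  exact (mul_eq_zero.1 h0).resolve_left (sub_ne_zero.2 (Ne.symm hc))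

end Summit.HodgeConjecture.HodgeConjecture.R90.S1

end
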